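import Summits.Ventures.HSemireg.OrlovIsometryGroupCM
import Mathlib.Algebra.QuadraticAlgebra.Basic
import Mathlib.Tactic.IntervalCases
import HarnessLib

/-!
# `U(E × Ê) = ℤ[ω]ˣ · SL₂(ℤ)` for an elliptic curve with complex multiplication by an imaginary-quadratic
# order `ℤ[ω]`; the cell anchors `E_ω` (`μ₆`) and `E_i` (`μ₄`)

Venture cell `pub-hsemireg`, literature seat `lit-w-polishchuk-orlov`; companion of
`OrlovIsometryGroupCM.lean` (the `2 × 2` matrix model `g · adj(σ g) = 1` of Orlov's
isometric automorphisms [Orlov2002DerivedAbelian, Def. 2.17], and the abstract theorem `U = μ · SL₂(ℤ)`).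
Here the abstract hypotheses are discharged for `R = ℤ[ω]`, `ω² = a + b ω`, `b² + 4a < 0` — Mathlib's
`QuadraticAlgebra ℤ a b` with `σ = star` (`star (x + y ω) = (x + b y) − y ω`, norm
`N(x + y ω) = x² + b x y − a y²`): `star` fixes exactly `ℤ`, `4 N = (2x + b y)² − (b² + 4a) y² ≥ 0`
vanishes only at `0`, `ζ ζ̄ = 1 ⟺ ζ ∈ ℤ[ω]ˣ`. Every CM elliptic curve over `ℂ` has `End(E)` of this form.
The two anchors of the cell: `E_ω : y² = x³ + 1`, `End = ℤ[ω]`, `ω² = −1 − ω` (`a = b = −1`), units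
`μ₆ = {±1, ±ω, ±(1 + ω)}`; `E_i : y² = x³ − x`, `End = ℤ[i]` (`a = −1`, `b = 0`), units `μ₄ = {±1, ±i}`.
So `U(E_ω × Ê_ω) = μ₆ · SL₂(ℤ)` and `U(E_i × Ê_i) = μ₄ · SL₂(ℤ)` (index `3`, resp. `2`, over the
`SL(2, ℤ)` that Orlov's Ex. 4.16 prints for `End = ℤ`). DERIVED statements (the cell's reading (Q1);
machine-checked there by exact enumeration, `widen/LIT-W/tools/q1_unitary_enum.py`), not quotations.
HONEST FRAMING: elementary algebra of `2 × 2` matrices over `ℤ[ω]`; nothing here constructs a derived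
category or an abelian variety, and nothing here says that HC, HC_CM or HC_AV holds.
-/

namespace Summit.Ventures.HSemireg

open Matrix
open scoped MatrixGroups

section ImaginaryQuadraticOrder

open QuadraticAlgebra

/-- `4 N(x + y ω) = (2x + b y)² − (b² + 4a) y²` in `ℤ[ω]`, `ω² = a + b ω`. -/
private theorem four_mul_norm (a b : ℤ) (z : QuadraticAlgebra ℤ a b) :
    4 * z.norm = (2 * z.re + b * z.im) ^ 2 + (-(b ^ 2 + 4 * a)) * z.im ^ 2 := by
  rw [norm_def]
  ring

/-- The norm of an imaginary-quadratic order is non-negative. -/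
private theorem norm_nonneg_of_disc_neg {a b : ℤ} (hD : b ^ 2 + 4 * a < 0)
    (z : QuadraticAlgebra ℤ a b) : 0 ≤ z.norm := by
  have h1 := sq_nonneg (2 * z.re + b * z.im)
  have h2 : 0 ≤ (-(b ^ 2 + 4 * a)) * z.im ^ 2 := mul_nonneg (by linarith) (sq_nonneg _)
  linarith [four_mul_norm a b z]

/-- The norm of an imaginary-quadratic order is definite. -/
private theorem eq_zero_of_norm_eq_zero {a b : ℤ} (hD : b ^ 2 + 4 * a < 0)
    (z : QuadraticAlgebra ℤ a b) (hz : z.norm = 0) : z = 0 := by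
  have h1 := sq_nonneg (2 * z.re + b * z.im)
  have h2 : 0 ≤ (-(b ^ 2 + 4 * a)) * z.im ^ 2 := mul_nonneg (by linarith) (sq_nonneg _)
  have h4 := four_mul_norm a b z
  have him : z.im = 0 := by
    have h3 : (-(b ^ 2 + 4 * a)) * z.im ^ 2 = 0 := by linarith
    rcases mul_eq_zero.1 h3 with h | h
    · exact absurd h (by linarith)
    · exact (pow_eq_zero_iff two_ne_zero).1 h
  have hre : z.re = 0 := by
    have h5 : (2 * z.re + b * z.im) ^ 2 = 0 := by linarith
    have h6 := (pow_eq_zero_iff two_ne_zero).1 h5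
    rw [him] at h6
    linarith
  ext <;> simp [him, hre]

/-- **`U(E × Ê) = ℤ[ω]ˣ · SL₂(ℤ)` for every imaginary-quadratic order `End(E) = ℤ[ω]`**
(`ω² = a + b ω`, discriminant `b² + 4a < 0`; Mathlib's `QuadraticAlgebra ℤ a b`, `σ` = the conjugation
`star`): `g · adj(ḡ) = 1 ⟺ g = ζ · h`, `ζ ∈ ℤ[ω]ˣ`, `h ∈ SL(2, ℤ)`. Instance of
`orlovIsometric_iff_exists_smul_specialLinearGroup`: `star` fixes exactly `ℤ`, `z z̄ = N(z) ≥ 0`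
vanishes only at `0`, and `ζ ζ̄ = 1 ⟺ ζ` is a unit. DERIVED HERE — the cell's reading (Q1) of Orlov's
Def. 2.17 [cite: Orlov2002DerivedAbelian, Def 2.17]; compare the printed Ex. 4.16 (`End = ℤ`:
`U ≅ SL(2, ℤ)`). -/
theorem quadraticInt_orlovIsometric_iff {a b : ℤ} (hD : b ^ 2 + 4 * a < 0)
    (g : Matrix (Fin 2) (Fin 2) (QuadraticAlgebra ℤ a b)) :
    g * adjugate (g.map (starRingEnd (QuadraticAlgebra ℤ a b))) = 1 ↔
      ∃ (ζ : (QuadraticAlgebra ℤ a b)ˣ) (k : SL(2, ℤ)), g = (ζ : QuadraticAlgebra ℤ a b) •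
        (k : Matrix (Fin 2) (Fin 2) ℤ).map (Int.castRingHom (QuadraticAlgebra ℤ a b)) := by
  have hσ : ∀ x : QuadraticAlgebra ℤ a b,
      starRingEnd (QuadraticAlgebra ℤ a b) (starRingEnd (QuadraticAlgebra ℤ a b) x) = x := fun x => by
    simp
  have hmulstar : ∀ x : QuadraticAlgebra ℤ a b,
      x * starRingEnd (QuadraticAlgebra ℤ a b) x = (x.norm : QuadraticAlgebra ℤ a b) := by
    intro x
    rw [starRingEnd_apply, ← algebraMap_norm_eq_mul_star,
      eq_intCast (algebraMap ℤ (QuadraticAlgebra ℤ a b))]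
  have hfix : ∀ x : QuadraticAlgebra ℤ a b, starRingEnd (QuadraticAlgebra ℤ a b) x = x →
      ∃ m : ℤ, (m : QuadraticAlgebra ℤ a b) = x := by
    intro x hx
    have him : x.im = 0 := by
      have h := congrArg QuadraticAlgebra.im hx
      simp only [starRingEnd_apply, im_star] at h
      omega
    exact ⟨x.re, by ext <;> simp [him]⟩
  have hnorm : ∀ x : QuadraticAlgebra ℤ a b, ∃ n : ℕ,
      x * starRingEnd (QuadraticAlgebra ℤ a b) x = n := by
    intro x
    refine ⟨(x.norm).toNat, ?_⟩
    rw [hmulstar, ← Int.cast_natCast, Int.toNat_of_nonneg (norm_nonneg_of_disc_neg hD x)]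
  have hdef : ∀ x : QuadraticAlgebra ℤ a b, x * starRingEnd (QuadraticAlgebra ℤ a b) x = 0 → x = 0 := by
    intro x hx
    rw [hmulstar, Int.cast_eq_zero] at hx
    exact eq_zero_of_norm_eq_zero hD x hx
  have hunit : ∀ l : QuadraticAlgebra ℤ a b, l * starRingEnd (QuadraticAlgebra ℤ a b) l = 1 ↔ IsUnit l := by
    intro l
    rw [hmulstar, Int.cast_eq_one, isUnit_iff_norm_isUnit, Int.isUnit_iff]
    constructor
    · exact fun h => Or.inl h
    · rintro (h | h)
      · exact h
      · exfalso
        have := norm_nonneg_of_disc_neg hD l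
        omega
  rw [orlovIsometric_iff_exists_smul_specialLinearGroup hσ hfix hnorm hdef]
  constructor
  · rintro ⟨l, k, hl, hgk⟩
    exact ⟨((hunit l).1 hl).unit, k, by simpa using hgk⟩
  · rintro ⟨ζ, k, hgk⟩
    exact ⟨(ζ : QuadraticAlgebra ℤ a b), k, (hunit _).2 ζ.isUnit, hgk⟩

/-- **The anchor `E_ω` (`y² = x³ + 1`, `End = ℤ[ω]`, `ω² = −1 − ω`): `U(E_ω × Ê_ω) = ℤ[ω]ˣ · SL₂(ℤ)`**
(`ℤ[ω]ˣ = μ₆`, see `eisensteinInt_units`; `SL(2, ℤ)` has index `3`). DERIVED HERE — the cell's reading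
(Q1) of Orlov's Def. 2.17 [cite: Orlov2002DerivedAbelian, Def 2.17] (machine-checked in the cell by exact
enumeration in boxes, `widen/LIT-W/tools/q1_unitary_enum.py`; this is the kernel leg). -/
theorem eisensteinInt_orlovIsometric_iff (g : Matrix (Fin 2) (Fin 2) (QuadraticAlgebra ℤ (-1) (-1))) :
    g * adjugate (g.map (starRingEnd (QuadraticAlgebra ℤ (-1) (-1)))) = 1 ↔
      ∃ (ζ : (QuadraticAlgebra ℤ (-1) (-1))ˣ) (k : SL(2, ℤ)), g = (ζ : QuadraticAlgebra ℤ (-1) (-1)) •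
        (k : Matrix (Fin 2) (Fin 2) ℤ).map (Int.castRingHom (QuadraticAlgebra ℤ (-1) (-1))) :=
  quadraticInt_orlovIsometric_iff (by norm_num) g

/-- **The anchor `E_i` (`y² = x³ − x`, `End = ℤ[i]`, `i² = −1`): `U(E_i × Ê_i) = ℤ[i]ˣ · SL₂(ℤ)`**
(`ℤ[i]ˣ = μ₄`, see `gaussInt_units`; `SL(2, ℤ)` has index `2`). DERIVED HERE — the cell's reading (Q1)
of Orlov's Def. 2.17 [cite: Orlov2002DerivedAbelian, Def 2.17]; compare the printed Ex. 4.16 (`End = ℤ`: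
`U ≅ SL(2, ℤ)`). -/
theorem gaussInt_orlovIsometric_iff (g : Matrix (Fin 2) (Fin 2) (QuadraticAlgebra ℤ (-1) 0)) :
    g * adjugate (g.map (starRingEnd (QuadraticAlgebra ℤ (-1) 0))) = 1 ↔
      ∃ (ζ : (QuadraticAlgebra ℤ (-1) 0)ˣ) (k : SL(2, ℤ)), g = (ζ : QuadraticAlgebra ℤ (-1) 0) •
        (k : Matrix (Fin 2) (Fin 2) ℤ).map (Int.castRingHom (QuadraticAlgebra ℤ (-1) 0)) :=
  quadraticInt_orlovIsometric_iff (by norm_num) g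

/-- **`ℤ[ω]ˣ = μ₆ = {±1, ±ω, ±(1 + ω)}`** (`ω² = −1 − ω`; `N(x + y ω) = x² − x y + y² = 1`).
[folklore] -/
theorem eisensteinInt_units (z : QuadraticAlgebra ℤ (-1) (-1)) :
    IsUnit z ↔ z = 1 ∨ z = -1 ∨ z = ω ∨ z = -ω ∨ z = 1 + ω ∨ z = -(1 + ω) := by
  rw [isUnit_iff_norm_isUnit, Int.isUnit_iff, norm_def]
  obtain ⟨x, y⟩ := z
  simp only [QuadraticAlgebra.ext_iff]
  constructor
  · rintro (h | h)
    · have hx : x ≤ 1 ∧ -1 ≤ x := by constructor <;> nlinarith [sq_nonneg (2 * y - x)]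
      have hy : y ≤ 1 ∧ -1 ≤ y := by constructor <;> nlinarith [sq_nonneg (2 * x - y)]
      obtain ⟨hx1, hx2⟩ := hx
      obtain ⟨hy1, hy2⟩ := hy
      interval_cases x <;> interval_cases y <;> simp_all
    · nlinarith [sq_nonneg (2 * x - y), sq_nonneg y]
  · rintro (h | h | h | h | h | h) <;> obtain ⟨h1, h2⟩ := h <;> simp_all

/-- **`ℤ[i]ˣ = μ₄ = {±1, ±i}`** (`i² = −1`; `N(x + y i) = x² + y² = 1`). [folklore] -/
theorem gaussInt_units (z : QuadraticAlgebra ℤ (-1) 0) :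
    IsUnit z ↔ z = 1 ∨ z = -1 ∨ z = ω ∨ z = -ω := by
  rw [isUnit_iff_norm_isUnit, Int.isUnit_iff, norm_def]
  obtain ⟨x, y⟩ := z
  simp only [QuadraticAlgebra.ext_iff]
  constructor
  · rintro (h | h)
    · have hx : x ≤ 1 ∧ -1 ≤ x := by constructor <;> nlinarith [sq_nonneg y]
      have hy : y ≤ 1 ∧ -1 ≤ y := by constructor <;> nlinarith [sq_nonneg x]
      obtain ⟨hx1, hx2⟩ := hx
      obtain ⟨hy1, hy2⟩ := hy
      interval_cases x <;> interval_cases y <;> simp_all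
    · nlinarith [sq_nonneg x, sq_nonneg y]
  · rintro (h | h | h | h) <;> obtain ⟨h1, h2⟩ := h <;> simp_all

end ImaginaryQuadraticOrder

end Summit.Ventures.HSemireg
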